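import Literature.NumberTheory.EllipticCurves.BigGaloisRepSelmer
import Summits.BirchSwinnertonDyer.BirchSwinnertonDyer.Theorems.ErratumRoadFiveBigRepInvariants
import Mathlib.GroupTheory.OrderOfElement
import HarnessLib

/-!
# Crux 4 `BSDpOnCellC` (stmt-BirchSwinnertonDyer-19034), line `telescope`, leaves N2 `stub_weightTwoControl` / N3
# `stub_memberControl`: `C c` ACTS SURJECTIVELY ON THE BIG MODULE `M₂ = A ⊗ Λ^*(Ψ⁻¹)` — the binder `hr` of
# `TelescopeK2WeightControl.twoSided_finite_control` / `quotXBig_equiv_dual_selmer_torsion` (p737740) and the inertia-type `hloc`,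
# for a GENERAL scalar `c ∈ 𝒪` (weight two `c = X`, members `c = X − x_k`), derived from N1's (tor)/(cof)/(fd) shapes
# (helper, `--supports stmt-BirchSwinnertonDyer-19034 --as helper`; closes nothing)

Cell `bsd-eis`, width seat `bsd-line-x2-p2` (prover g19, 2026-08-29; D-0154 KEY row 5). THEOREMS ONLY: no definition, no named
fact, no `sorry`, no instance, no notation. Companion of `…TelescopeK2GlobalDefectFinite` / `…GlobalDefectInputs` (same seat; the
`hglob` binder); this file supplies the binder `hr : Function.Surjective fun m : BigRepModule 𝒪 p A => (C c) • m` of the tree's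
control theorems (p737740) — the tree had it for the scalar `c = p` only (`Rank1Residual.X11b.BigRep.C_smul_surjective`,
`ErratumRoadFiveBigRepInvariants`).

## What is proved (unconditional; binders only; general coefficient ring `𝒪`)

* §1 `smul_surjective_of_primaryRoots` / **`C_smul_surjective_of_primaryRoots`** — `Φ ↦ (C c) • Φ` is onto `BigRepModule 𝒪 p A`
  as soon as every `p`-primary `a ∈ A` has a `p`-PRIMARY `c`-th root (pointwise section through the finitely many values; the
  level is preserved and the section's values stay `p`-primary).
* §2 `exists_primaryRoot_of_divisible` — that hypothesis from N1's (cof) «`∀ a, ∃ b, c • b = a`» when `A` is a TORSION group: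
  a root `b` of order `p^j·m`, `p ∤ m`, is replaced by `(m u) • b` with `m u ≡ 1 (mod p^k)` (Bézout), which is `p`-primary and
  still a root of the `p^k`-torsion element `a`.
* §3 `isOfFinAddOrder_of_torsionBy` / `isOfFinAddOrder_of_pow_torsion` — `A` IS a torsion group under N1's (tor) «`c`-power
  torsion» and (fd₀) «an additive `θ₀ : A[c] → P` with FINITE kernel into a torsion group `P`» (`P = E[p^∞]`): the `c`-torsion
  is torsion (its image and the finite kernel are), then induction on the `c`-exponent.
* §4 **`C_smul_surjective_of_leafShapes`** — the assembly: (tor) + (cof) + (fd₀)-shape ⇒ `hr` at `r = C c`; and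
  **`divisibleInvariants_bigRep_restrict_of_trivial`** — the inertia-type `hloc` of `twoSided_finite_control` at `r = C c`
  («`∀ w ∈ (M|_H)^H, ∃ w' ∈ (M|_H)^H, (C c) • w' = w`» along `φ : H → G` with `κ ∘ φ = 1`, `ρ ∘ φ` trivial: an unramified
  `w ∉ S₀`, `w ∤ p`), from the same surjectivity (tree `bigRep_restrict_invariants_eq_top`).

HONEST FRAMING: elementary algebra on the constructed co-induced model over binders; nothing about any curve, newform or branch
lattice is asserted; BSD is proved for no pair; no registered stub, crux or summit statement is proved by this file; closes: none.

References: [Skinner2016PacificMC] §2.3, proof of Lemma 2.3.1 (p. 180: «`Λ_𝒪^*` … is `p`-divisible»); [Castella2018Erratum] §2,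
Lemma 2.1 (p. 2: the specialisation sequence `0 → M_g[ϖ^m] → M_g → M_g → 0`); [GreenbergLNM1716] §4 (torsion bookkeeping).
-/

noncomputable section

-- D-0017: single-problem summit, the namespace repeats the problem name by design.
set_option linter.dupNamespace false
set_option autoImplicit false

open Literature.NumberTheory.GaloisRepresentations Literature.NumberTheory.EllipticCurves
  Literature.NumberTheory.EllipticCurves.BigRepModule

namespace Summit.BirchSwinnertonDyer.BirchSwinnertonDyer.Theorems.TelescopeK2BigRepDivisible

/-! ## §1 Surjectivity of `Φ ↦ c • Φ` from `p`-primary roots -/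

section Surjective

variable {𝒪 : Type*} [CommRing 𝒪] {p : ℕ} [Fact p.Prime] {A : Type*} [AddCommGroup A] [Module 𝒪 A]

/-- **`Φ ↦ c • Φ` is onto `A ⊗ Λ^*`** when every `p`-primary `a ∈ A` has a `p`-primary `c`-th root: a section is taken
pointwise through the values (locally constant of the same level; `p`-primary values).
[cite: Skinner2016PacificMC, §2.3, proof of Lemma 2.3.1 (p. 180)] -/
theorem smul_surjective_of_primaryRoots (c : 𝒪)
    (hA : ∀ a : A, (∃ k : ℕ, p ^ k • a = 0) → ∃ b : A, (∃ k : ℕ, p ^ k • b = 0) ∧ c • b = a) :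
    Function.Surjective fun Φ : BigRepModule 𝒪 p A => c • Φ := by
  classical
  -- a pointwise section through the `p`-primary values
  set sec : A → A := fun a => if h : ∃ k : ℕ, p ^ k • a = 0 then Classical.choose (hA a h) else 0
    with hsec_def
  have hsec : ∀ a : A, (h : ∃ k : ℕ, p ^ k • a = 0) → (∃ k : ℕ, p ^ k • sec a = 0) ∧ c • sec a = a := by
    intro a h
    rw [hsec_def]
    simp only [dif_pos h]
    exact Classical.choose_spec (hA a h)
  intro Φ
  obtain ⟨n, hn⟩ := Φ.exists_level
  obtain ⟨t, ht⟩ := Φ.exists_torsion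
  have htor : ∀ x : ℤ_[p], ∃ k : ℕ, p ^ k • Φ x = 0 := fun x => ⟨t, ht x⟩
  choose kA hkA using fun x : ℤ_[p] => (hsec (Φ x) (htor x)).1
  refine ⟨BigRepModule.mk (fun x => sec (Φ x)) ⟨⟨n, fun x y hxy => congrArg sec (hn x y hxy)⟩,
    ⟨(Finset.range (p ^ n)).sup (fun i : ℕ => kA (i : ℤ_[p])), fun x => ?_⟩⟩, ?_⟩
  · -- a uniform exponent through the finitely many values `Φ i`, `i < p^n`
    have hx : Φ x = Φ ((x.appr n : ℕ) : ℤ_[p]) := hn _ _ (PadicInt.appr_spec n x)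
    change p ^ _ • sec (Φ x) = 0
    rw [hx]
    have hi : x.appr n ∈ Finset.range (p ^ n) := Finset.mem_range.mpr (PadicInt.appr_lt x n)
    obtain ⟨d, hd⟩ := Nat.exists_eq_add_of_le (Finset.le_sup (f := fun i : ℕ => kA (i : ℤ_[p])) hi)
    rw [hd, pow_add, mul_comm, mul_smul, hkA, smul_zero]
  · ext x
    change (c • BigRepModule.mk (fun x => sec (Φ x)) _) x = Φ x
    rw [BigRepModule.smul_apply, BigRepModule.mk_apply]
    exact (hsec (Φ x) (htor x)).2

/-- **`hr`: `Φ ↦ (C c) • Φ` is onto `A ⊗ Λ^*`** (the scalar of the control theorems: `C c` acts as `c` on the values,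
`BigRepModule.C_smul`), same hypothesis. [cite: Skinner2016PacificMC, §2.3, proof of Lemma 2.3.1 (p. 180)]
[cite: Castella2018Erratum, Lemma 2.1 (p. 2)] -/
theorem C_smul_surjective_of_primaryRoots (c : 𝒪)
    (hA : ∀ a : A, (∃ k : ℕ, p ^ k • a = 0) → ∃ b : A, (∃ k : ℕ, p ^ k • b = 0) ∧ c • b = a) :
    Function.Surjective fun Φ : BigRepModule 𝒪 p A => (PowerSeries.C c : PowerSeries 𝒪) • Φ := by
  intro Φ
  obtain ⟨Ψ, hΨ⟩ := smul_surjective_of_primaryRoots (p := p) c hA Φ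
  refine ⟨Ψ, ?_⟩
  change (PowerSeries.C c : PowerSeries 𝒪) • Ψ = Φ
  rw [C_smul]
  exact hΨ

end Surjective

/-! ## §2 `p`-primary roots from plain divisibility in a torsion group -/

section Roots

variable {𝒪 : Type*} [CommRing 𝒪] {p : ℕ} [Fact p.Prime] {A : Type*} [AddCommGroup A] [Module 𝒪 A]

/-- **A `p`-primary `c`-th root from any `c`-th root of finite order**: if `p^k • a = 0`, `c • b = a` and `b` has finite additive
order `p^j · m`, `p ∤ m`, then `b' = (m u) • b` with `m u + p^k v = 1` is `p`-primary (`p^j • b' = 0`) and `c • b' = a`.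
[cite: GreenbergLNM1716, §4 (torsion bookkeeping)] [folklore] -/
theorem exists_primaryRoot_of_root_of_isOfFinAddOrder (c : 𝒪) {a b : A} {k : ℕ} (hk : p ^ k • a = 0) (hb : c • b = a)
    (hfin : IsOfFinAddOrder b) : ∃ b' : A, (∃ j : ℕ, p ^ j • b' = 0) ∧ c • b' = a := by
  have hp : p.Prime := Fact.out
  obtain ⟨N, hNpos, hN⟩ := (isOfFinAddOrder_iff_nsmul_eq_zero).1 hfin
  obtain ⟨j, m, hpm, hNjm⟩ := Nat.exists_eq_pow_mul_and_not_dvd hNpos.ne' p hp.one_lt.ne'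
  -- Bézout: `m u + p^k v = 1`
  have hcop : Nat.Coprime m (p ^ k) := (Nat.Coprime.pow_right k ((Nat.Prime.coprime_iff_not_dvd hp).2 hpm).symm)
  have hbez : (m : ℤ) * (m : ℤ).gcdA (p ^ k : ℕ) + ((p ^ k : ℕ) : ℤ) * (m : ℤ).gcdB (p ^ k : ℕ) = 1 := by
    rw [← Int.gcd_eq_gcd_ab, Int.gcd_natCast_natCast, hcop]
    rfl
  refine ⟨((m : ℤ) * (m : ℤ).gcdA (p ^ k : ℕ)) • b, ⟨j, ?_⟩, ?_⟩
  · -- `p^j • ((m u) • b) = u • ((p^j m) • b) = 0`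
    rw [smul_comm, mul_comm, mul_smul, ← natCast_zsmul b, smul_smul ((m : ℤ)) , ← Nat.cast_mul,
      natCast_zsmul, mul_comm, ← hNjm, hN, smul_zero]
  · -- `c • ((m u) • b) = (m u) • a = (1 - p^k v) • a = a`
    rw [smul_comm, hb, show ((m : ℤ) * (m : ℤ).gcdA (p ^ k : ℕ)) = 1 - (m : ℤ).gcdB (p ^ k : ℕ) * ((p ^ k : ℕ) : ℤ) by
      rw [← hbez]; ring, sub_smul, one_smul, mul_smul, natCast_zsmul, hk, smul_zero, sub_zero]

/-- **(cof) + torsion ⇒ `p`-primary roots**: if every element of `A` has a `c`-th root and every element of `A` has finite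
additive order, then every `p`-primary element has a `p`-primary `c`-th root (the hypothesis of §1).
[cite: GreenbergLNM1716, §4 (torsion bookkeeping)] [folklore] -/
theorem exists_primaryRoot_of_divisible (c : 𝒪) (hdiv : ∀ a : A, ∃ b : A, c • b = a)
    (htors : ∀ a : A, IsOfFinAddOrder a) :
    ∀ a : A, (∃ k : ℕ, p ^ k • a = 0) → ∃ b : A, (∃ k : ℕ, p ^ k • b = 0) ∧ c • b = a := by
  rintro a ⟨k, hk⟩
  obtain ⟨b, hb⟩ := hdiv a
  exact exists_primaryRoot_of_root_of_isOfFinAddOrder (p := p) c hk hb (htors b)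

end Roots

/-! ## §3 `A` is a torsion group under (tor) and the (fd₀)-shape -/

section Torsion

universe w

variable {𝒪 : Type*} [CommRing 𝒪] [TopologicalSpace 𝒪]
  {A : Type w} [AddCommGroup A] [Module 𝒪 A] [TopologicalSpace A]
  {G : Type w} [Group G] [TopologicalSpace G]

omit [TopologicalSpace 𝒪] [TopologicalSpace A] [Group G] [TopologicalSpace G] in
/-- **The `c`-torsion is torsion** when an additive map `θ₀ : A[c] → P` with finite kernel lands in a torsion group `P`
(the (fd₀) quasi-isomorphism `A₂[X] → E[p^∞]` of N1). [cite: GreenbergLNM1716, §4 (torsion bookkeeping)] [folklore] -/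
theorem isOfFinAddOrder_of_torsionBy (c : 𝒪) {P : Type*} [AddCommGroup P]
    (θ₀ : Submodule.torsionBy 𝒪 A c →+ P) (hker : Finite θ₀.ker) (hP : ∀ e : P, IsOfFinAddOrder e)
    (a : A) (ha : c • a = 0) : IsOfFinAddOrder a := by
  let x : Submodule.torsionBy 𝒪 A c := ⟨a, (Submodule.mem_torsionBy_iff c a).2 ha⟩
  obtain ⟨n, hnpos, hn⟩ := (isOfFinAddOrder_iff_nsmul_eq_zero).1 (hP (θ₀ x))
  have hmem : n • x ∈ θ₀.ker := by rw [AddMonoidHom.mem_ker, map_nsmul, hn]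
  haveI := hker
  obtain ⟨m, hmpos, hm⟩ := (isOfFinAddOrder_iff_nsmul_eq_zero).1 (isOfFinAddOrder_of_finite (⟨n • x, hmem⟩ : θ₀.ker))
  refine (isOfFinAddOrder_iff_nsmul_eq_zero).2 ⟨m * n, Nat.mul_pos hmpos hnpos, ?_⟩
  have hm' : m • (n • x) = 0 := by
    have := congrArg (fun z : θ₀.ker => ((z : Submodule.torsionBy 𝒪 A c))) hm
    simpa using this
  have := congrArg (fun z : Submodule.torsionBy 𝒪 A c => (z : A)) hm'
  simpa [mul_smul, x] using this

omit [TopologicalSpace 𝒪] [TopologicalSpace A] [Group G] [TopologicalSpace G] in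
/-- **`A` is a torsion group** when it is `c`-power torsion ((tor) of N1) and its `c`-torsion is torsion (previous lemma):
induction on the `c`-exponent. [cite: GreenbergLNM1716, §4 (torsion bookkeeping)] [folklore] -/
theorem isOfFinAddOrder_of_pow_torsion (c : 𝒪) (htor : ∀ a : A, ∃ n : ℕ, c ^ n • a = 0)
    (hc : ∀ a : A, c • a = 0 → IsOfFinAddOrder a) (a : A) : IsOfFinAddOrder a := by
  have key : ∀ n : ℕ, ∀ a : A, c ^ n • a = 0 → IsOfFinAddOrder a := by
    intro n
    induction n with
    | zero =>
      intro a ha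
      rw [pow_zero, one_smul] at ha
      rw [ha]
      exact IsOfFinAddOrder.zero
    | succ n ih =>
      intro a ha
      -- `c^n • a ∈ A[c]` has finite order `N₁`, and `c^n • (N₁ • a) = 0`
      rw [pow_succ', mul_smul] at ha
      obtain ⟨N₁, hN₁pos, hN₁⟩ := (isOfFinAddOrder_iff_nsmul_eq_zero).1 (hc _ ha)
      have h2 : c ^ n • (N₁ • a) = 0 := by rw [smul_comm, hN₁]
      obtain ⟨N₂, hN₂pos, hN₂⟩ := (isOfFinAddOrder_iff_nsmul_eq_zero).1 (ih _ h2)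
      exact (isOfFinAddOrder_iff_nsmul_eq_zero).2 ⟨N₂ * N₁, Nat.mul_pos hN₂pos hN₁pos, by rw [mul_smul, hN₂]⟩
  obtain ⟨n, hn⟩ := htor a
  exact key n a hn

end Torsion

/-! ## §4 Assembly in the leaf shapes: `hr` and the inertia-type `hloc` at `r = C c` -/

section Assembly

universe w

variable {𝒪 : Type*} [CommRing 𝒪] [TopologicalSpace 𝒪] {p : ℕ} [Fact p.Prime]
  {A : Type w} [AddCommGroup A] [Module 𝒪 A] [TopologicalSpace A] [DiscreteTopology A]
  {G : Type w} [Group G] [TopologicalSpace G] [ContinuousMul G]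

omit [TopologicalSpace 𝒪] [TopologicalSpace A] [DiscreteTopology A] [Group G] [TopologicalSpace G] [ContinuousMul G] in
/-- **`hr` FROM THE LEAF SHAPES**: (tor) `c`-power torsion + (cof) `c`-divisibility + the (fd₀)-shape «an additive
`θ₀ : A[c] → P` with finite kernel into a torsion group» ⇒ `Φ ↦ (C c) • Φ` is onto `M₂ = A ⊗ Λ^*` — the binder `hr` of
`TelescopeK2WeightControl.twoSided_finite_control` / `quotXBig_equiv_dual_selmer_torsion` / `finite_ker_torsionInclH1_of_finite_quot`
(p737740) at `r = C c` (weight two: `c = X`, `θ₀` = N1's (fd₀), `P = E[p^∞]`).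
[cite: Castella2018Erratum, Lemma 2.1 (p. 2)] [cite: Skinner2016PacificMC, §2.3, proof of Lemma 2.3.1 (p. 180)] -/
theorem C_smul_surjective_of_leafShapes (c : 𝒪) (htor : ∀ a : A, ∃ n : ℕ, c ^ n • a = 0)
    (hdiv : ∀ a : A, ∃ b : A, c • b = a) {P : Type*} [AddCommGroup P]
    (θ₀ : Submodule.torsionBy 𝒪 A c →+ P) (hker : Finite θ₀.ker) (hP : ∀ e : P, IsOfFinAddOrder e) :
    Function.Surjective fun Φ : BigRepModule 𝒪 p A => (PowerSeries.C c : PowerSeries 𝒪) • Φ :=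
  C_smul_surjective_of_primaryRoots c (exists_primaryRoot_of_divisible c hdiv
    (isOfFinAddOrder_of_pow_torsion c htor (isOfFinAddOrder_of_torsionBy c θ₀ hker hP)))

variable (κ : G →ₜ* Multiplicative ℤ_[p]) (ρ : ContinuousRep G 𝒪 A) [TopologicalSpace (PowerSeries 𝒪)]
  [ContinuousSMul (PowerSeries 𝒪) (BigRepModule 𝒪 p A)]
  {H : Type*} [Group H] [TopologicalSpace H]

/-- **`hloc` at an INERTIA-type index for the scalar `C c`**: along `φ : H → G` with `κ ∘ φ = 1` and `ρ ∘ φ` trivial (the inertia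
group at an unramified `w ∉ S₀`, `w ∤ p`: the `ℤ_p`-extension is unramified outside `p`), the invariants of `M|_H` are ALL of `M`
(tree `bigRep_restrict_invariants_eq_top`) and are `(C c)`-divisible as soon as `M` is — the shape
«`∀ w ∈ (M|_H)^H, ∃ w' ∈ (M|_H)^H, r • w' = w`» of `twoSided_finite_control`'s `hloc` at `r = C c`.
[cite: Skinner2016PacificMC, §2.3, Lemma 2.3.1 and its proof (p. 180)] [cite: Castella2018Erratum, Lemma 2.1 (p. 2)] -/
theorem divisibleInvariants_bigRep_restrict_of_trivial (c : 𝒪) (φ : H →ₜ* G)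
    (hκ : ∀ h : H, κ (φ h) = 1) (hρ : ∀ (h : H) (a : A), ρ (φ h) a = a)
    (hr : Function.Surjective fun Φ : BigRepModule 𝒪 p A => (PowerSeries.C c : PowerSeries 𝒪) • Φ) :
    ∀ w ∈ (((bigRep (p := p) κ ρ).restrict φ).toTopRep).ρ.invariants,
      ∃ w' ∈ (((bigRep (p := p) κ ρ).restrict φ).toTopRep).ρ.invariants,
        (PowerSeries.C c : PowerSeries 𝒪) • w' = w := by
  intro w _
  obtain ⟨w', hw'⟩ := hr w
  refine ⟨w', ?_, hw'⟩
  rw [Summit.BirchSwinnertonDyer.Rank1Residual.X11b.BigRep.bigRep_restrict_invariants_eq_top κ ρ φ hκ hρ]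
  exact Submodule.mem_top

end Assembly

end Summit.BirchSwinnertonDyer.BirchSwinnertonDyer.Theorems.TelescopeK2BigRepDivisible

end
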